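import Summits.QuantumFields.YangMills.Theorems.BalabanUVNodesN07LaplaceAOfRecordGaugeOrbitPos
import Literature.MathematicalPhysics.QuantumFieldTheory.Balaban1983to89.Node00.BgGaugeLetterOfRecord
import HarnessLib

/-!
# NODE N07 — [B9] (3.34b)∕(3.153) AND [15] (117) AT THE RECORD: def-Y's HANDLE `𝔊(U₀) = frakGOfRecordAtBgFlat` IS GAUGE COVARIANT AND ITS
# (117)-NORM IS GAUGE INVARIANT (conjunct C4 of ⟨26900⟩ `P0Content` is a property of the gauge orbit)

Cell `pub-ymgap`, width seat `pub-ymgap-dag-n07-w3` (g24), CLAIM-6.  `--kind proof --supports stmt-QuantumFields-27238 --as helper`; count-neutral.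
[B9] = [Balaban1985BackgroundPropagators]; [15] = [Balaban1985Variational].

WHY.  [B9] p.396–398: with (3.30)–(3.34) every propagator of Sect. 3 transforms by `R(u) · R(u⁻¹)` («G₁(U^u) = R(u)G₁(U)R(u⁻¹)» (3.34b); 𝔊 = G₁𝔓*, (3.153) p.426),
and *«All these inequalities are invariant with respect to gauge transformations of U»* (p.398) — the reduction that lets every bound, in particular [15] (117)
`‖𝔊‖ ≤ B₀` (= conjunct C4 of the cell's `P0Content` row, stated over def-Y's `frakGOfRecordAtBgFlat`), be proved in a convenient gauge.  ✓p817063 gave (3.34a)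
for the pinned `Δ_{1,a}`; this file pushes it through lit's constructed letters `G₁ = G1LatticeK`, `(QG₁Q*)⁻¹ = KinvLatticeK`, `𝔊 = frakG … (frakGLin …)` and through
the (115)∕(−3) carriers of record, whose weighted sup-norms of the `L²`-operator matrix norm are `Ad`-invariant.

WHAT IS PROVED (sorry-free; no definition; axioms standard).
* §1 `norm_AdA_suToUnits` (`‖sXs⋆‖ = ‖X‖`, C⋆-norm), `funEquiv_gaugeW`, `funEquiv_symm_AdA` (lit's `gaugeW` read on the functions is `b ↦ Ad_{u(b₋)}`).
* §2 Hilbert level, on 35b's guard (`k ≤ m + K`): `QOfRecord_surjective_gaugeAct` (`hQ(U₀) ⟹ hQ(u • U₀)`), `laplaceAOfRecord_injective` (from `hpos`),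
  ★ `G1LatticeK_gaugeAct` ((3.34b): `G₁(u • U₀) R(u) = R(u) G₁(U₀)`), `QG1Qadj_gaugeAct`, ★ `KinvLatticeK_gaugeAct` (`(QG₁Q*)⁻¹` intertwined by `R_k(u)`),
  ★★ `frakGOfRecordAtBgFlat_equiv` (bookkeeping: the configuration `𝔊f` IS `G₁𝔓*` of the Hilbert letters read through `phiRec`), ★★ `frakGOfRecordAtBgFlat_gaugeAct`
  (`𝔊(u • U₀)(Ad_u f) = Ad_u (𝔊(U₀) f)` on the underlying functions).
* §3 ★ `nabla115_unitsOfRecord_gaugeAct` (the (115)-derivative is covariant), `norm_negSizeLit_AdA`, `norm_space115Lit_AdA` (the carriers' norms are `Ad`-invariant).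
* §4 ★★★ `norm_frakGOfRecordAtBgFlat_gaugeAct : ‖frakGOfRecordAtBgFlat F N K k Ω (u • U₀) a hpos′ hQ′‖ = ‖frakGOfRecordAtBgFlat F N K k Ω U₀ a hpos hQ‖` — [15] (117)'s
  left-hand side is GAUGE INVARIANT along orbits on the guard; ★★★ `norm_frakGOfRecordAtBgFlat_pureGauge` (every pure gauge `u • 1` has the flat background's (117)-norm).
  (15 theorems.)

HONEST SCOPE.  Covariance∕invariance identities only: (117) `‖𝔊‖ ≤ B₀` is NOT proved at any background (not even `U₀ = 1`); `hpos`, `hQ` stay DISPLAYED (inhabited on the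
flat orbit by ✓p817063 ∕ ✓p815831 + `QOfRecord_surjective_gaugeAct`); the `L²`-operator matrix norm of 3a (`open scoped Matrix.Norms.L2Operator`) is the one used; nothing of
[B9]∕[15] asserted; P0 OPEN; N07 NOT discharged; K0ᴬ∕K1ᴬ∕K3ᴬ OPEN; counts unmoved (28∕28 · 8∕28 · K 1∕4); one finite 𝕋⁴ programme at fixed ε — R4 closes the conditional
finite-𝕋⁴ rung `BalabanLadder.UV` only, never the summit; nothing continuum ∕ ℝ⁴ ∕ OS; the Yang–Mills mass gap (Clay) is NOT proved by any of this.
No `sorry`, no `def`, no `instance`, no `notation`.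

References: [B9] (3.28)–(3.34) pp.395–396, (3.147)–(3.153) pp.425–426, p.398; [15] (110)–(111) p.294, (115)–(117) pp.294–295, (45) p.285.
-/

set_option autoImplicit false

noncomputable section

open scoped Matrix.Norms.L2Operator InnerProductSpace ComplexConjugate

namespace Summit.QuantumFields.YangMills.Theorems.N07FrakGOfRecordGaugeCovariance

open Literature.MathematicalPhysics.QuantumFieldTheory.Balaban1983to89
open Literature.MathematicalPhysics.QuantumFieldTheory.Balaban1983to89.T4Continuum (T4Family)
open T4Continuum BlockAveraging
open B4Sect5Torus (TSite)
open B9SectCLatticeCarrier (Bond bpos btgt)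
open B9Eq311L2Pairing (WL2)
open B11Eq115Space (NegSup JetSup)
open B11Eq111FrakG (nabla115 nabla115_apply frakG_apply frakGLin_apply)
open B11Eq103H1Complex (SiteL2K BondL2K covDerivL2K covDivL2K funEquiv funEquiv_apply funEquiv_symm_apply readFun_apply G1Fun QFun QadjFun DFun DstarFun
  G1LatticeK KinvLatticeK laplaceALatticeK_G1LatticeK hK_lattice)
open B9Eq328GaugeAction (gaugeU gaugeU_apply gaugeW AdW AdA AdA_apply AdA_apply_inv AdA_inv_apply apply_AdW AdW_apply equiv_gaugeW gaugeW_apply_inv gaugeW_inv_apply)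
open B16Sect1Backgrounds (toMS)
open Node00
open Summit.QuantumFields.YangMills.Theorems.N07LaplaceAOfRecordGaugeOrbitPos (unitsOfRecord_gaugeAct laplaceAOfRecord_gaugeAct QOfRecord_gaugeAct_bpos
  adjoint_QOfRecord_gaugeAct covDerivL2K_RRec_gaugeAct covDivL2K_SRec_gaugeAct RrOfRecord_gaugeAct suToUnits_inv)
open GaugeField (gaugeAct)

variable (F : T4Family) (N : ℕ) [NeZero N] {K : ℕ} (k : ℕ)

/-! ## §1  The fibre isometry `X ↦ sXs⋆` and lit's `R(u)` read on the functions -/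

omit [NeZero N] in
/-- `‖s X s⁻¹‖ = ‖X‖` for `s ∈ SU(N)` in the `L²`-operator (C⋆) norm of `M_N(ℂ)`. [cite: Balaban1985BackgroundPropagators, (3.31) p.395 («R(u) is an orthogonal transformation»)] -/
theorem norm_AdA_suToUnits (s : SU N) (X : Matrix (Fin N) (Fin N) ℂ) : ‖AdA (suToUnits N s) X‖ = ‖X‖ := by
  rw [AdA_apply, coe_suToUnits_inv, coe_inv_SU, coe_suToUnits]
  have hs : (s : Matrix (Fin N) (Fin N) ℂ) ∈ unitary (Matrix (Fin N) (Fin N) ℂ) := Matrix.specialUnitaryGroup_le_unitaryGroup s.2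
  have hs' : star (s : Matrix (Fin N) (Fin N) ℂ) ∈ unitary (Matrix (Fin N) (Fin N) ℂ) := by
    rw [← coe_inv_SU]
    exact Matrix.specialUnitaryGroup_le_unitaryGroup (s⁻¹).2
  rw [mul_assoc, CStarRing.norm_coe_unitary_mul ⟨_, hs⟩]
  exact CStarRing.norm_mul_coe_unitary X ⟨_, hs'⟩

omit [NeZero N] in
/-- Lit's `gaugeW` read on the functions: `(funEquiv φ w (R(g) x))(i) = Ad_{g(i)} ((funEquiv φ w x)(i))`. [cite: Balaban1985BackgroundPropagators, (3.28) p.395] -/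
theorem funEquiv_gaugeW {ι : Type*} (w : ι → ℝ) (g : ι → (Matrix (Fin N) (Fin N) ℂ)ˣ) (x : WL2 ℂ w (WRec N)) :
    funEquiv (phiRec N) w (gaugeW (phiRec N) g x) = fun i => AdA (g i) (funEquiv (phiRec N) w x i) := by
  funext i
  rw [funEquiv_apply, equiv_gaugeW, apply_AdW, funEquiv_apply]

omit [NeZero N] in
/-- Conversely: reading `i ↦ Ad_{g(i)} G(i)` back into the weighted `L²` space gives `R(g)` of the read-back of `G`. [cite: Balaban1985BackgroundPropagators, (3.28) p.395] -/
theorem funEquiv_symm_AdA {ι : Type*} (w : ι → ℝ) (g : ι → (Matrix (Fin N) (Fin N) ℂ)ˣ) (G : ι → Matrix (Fin N) (Fin N) ℂ) :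
    (funEquiv (phiRec N) w).symm (fun i => AdA (g i) (G i)) = gaugeW (phiRec N) g ((funEquiv (phiRec N) w).symm G) := by
  apply (funEquiv (phiRec N) w).injective
  rw [LinearEquiv.apply_symm_apply, funEquiv_gaugeW, LinearEquiv.apply_symm_apply]

/-! ## §2  Hilbert level: `hQ` along orbits, `G₁`, `(QG₁Q*)⁻¹` and `𝔊 = G₁𝔓*` are intertwined by `R(u)` ([B9] (3.34b), (3.153)) -/

section Hilbert

variable (u : GaugeTransf (F.P K) 0 (SU N)) (U₀ : GaugeField (F.P K) 0 (SU N))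

/-- **`hQ` TRANSFERS ALONG GAUGE ORBITS** (on the guard): `Q(U₀)` onto ⟹ `Q(u • U₀)` onto, by (3.32) `Q(u • U₀)R(u) = R_k(u)Q(U₀)` and bijectivity of `R_k(u)`.
[cite: Balaban1985BackgroundPropagators, (3.32) p.396, (3.19) p.393] -/
theorem QOfRecord_surjective_gaugeAct (hk : k ≤ (F.P K).m + (F.P K).K) (h : SmallBelow (avOfRecord F N K) k U₀)
    (hQ : Function.Surjective (QOfRecord F N k U₀)) : Function.Surjective (QOfRecord F N k (gaugeAct u U₀)) := by
  intro y
  obtain ⟨x, hx⟩ := hQ (gaugeW (phiRec N) (fun c : PBond (F.P K) k => suToUnits N (toMS u k c.src))⁻¹ y)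
  refine ⟨gaugeW (phiRec N) (fun b : Bond (F.P K).d (fun _ => (F.P K).sitesPerDir 0) => suToUnits N (u ((siteToLit (F.P K) 0).symm (bpos b)))) x, ?_⟩
  rw [QOfRecord_gaugeAct_bpos F N k u U₀ hk h, hx, gaugeW_apply_inv]

omit [NeZero N] in
/-- The displayed positivity makes `Δ_{1,a}(U₀)` injective. [cite: Balaban1985BackgroundPropagators, Thm 3.11 p.416] -/
theorem laplaceAOfRecord_injective [Fact (0 < c0Rec F K k)] [Fact (∀ c, 0 < wBRec F K k c)] {a : ℝ}
    (hpos : ∀ x, x ≠ 0 → 0 < RCLike.re ⟪x, laplaceAOfRecord F N k U₀ (QOfRecord F N k U₀) (QflatOfRecord F N k) a x⟫_ℂ) :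
    Function.Injective (laplaceAOfRecord F N k U₀ (QOfRecord F N k U₀) (QflatOfRecord F N k) a) := by
  intro y z hyz
  by_contra hne
  have h := hpos (y - z) (sub_ne_zero.2 hne)
  rw [map_sub, hyz, sub_self, inner_zero_right, map_zero] at h
  exact lt_irrefl _ h

/-- ★ **(3.34b) AT THE RECORD: `G₁(u • U₀) R(u) = R(u) G₁(U₀)`** for lit's constructed `G₁ = G1LatticeK hpos` (the inverse of the pinned `Δ_{1,a}`), from (3.34a)
✓`laplaceAOfRecord_gaugeAct` and `Δ_{1,a}G₁ = 1`. [cite: Balaban1985BackgroundPropagators, (3.34) p.396; Balaban1985Variational, (110) p.294] -/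
theorem G1LatticeK_gaugeAct [Fact (0 < c0Rec F K k)] [Fact (∀ c, 0 < wBRec F K k c)] (hk : k ≤ (F.P K).m + (F.P K).K)
    (h : SmallBelow (avOfRecord F N K) k U₀) {a : ℝ}
    (hpos : ∀ x, x ≠ 0 → 0 < RCLike.re ⟪x, laplaceAOfRecord F N k U₀ (QOfRecord F N k U₀) (QflatOfRecord F N k) a x⟫_ℂ)
    (hpos' : ∀ x, x ≠ 0 → 0 < RCLike.re ⟪x, laplaceAOfRecord F N k (gaugeAct u U₀) (QOfRecord F N k (gaugeAct u U₀)) (QflatOfRecord F N k) a x⟫_ℂ)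
    (x : BondL2K ℂ (F.P K).d (fun _ => (F.P K).sitesPerDir 0) (c0Rec F K k) (WRec N)) :
    G1LatticeK hpos' (gaugeW (phiRec N) (fun b : Bond (F.P K).d (fun _ => (F.P K).sitesPerDir 0) => suToUnits N (u ((siteToLit (F.P K) 0).symm (bpos b)))) x) =
      gaugeW (phiRec N) (fun b : Bond (F.P K).d (fun _ => (F.P K).sitesPerDir 0) => suToUnits N (u ((siteToLit (F.P K) 0).symm (bpos b))))
        (G1LatticeK hpos x) := by
  apply laplaceAOfRecord_injective F N k (gaugeAct u U₀) hpos'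
  have h1 : laplaceAOfRecord F N k (gaugeAct u U₀) (QOfRecord F N k (gaugeAct u U₀)) (QflatOfRecord F N k) a (G1LatticeK hpos'
      (gaugeW (phiRec N) (fun b : Bond (F.P K).d (fun _ => (F.P K).sitesPerDir 0) => suToUnits N (u ((siteToLit (F.P K) 0).symm (bpos b)))) x)) =
      gaugeW (phiRec N) (fun b : Bond (F.P K).d (fun _ => (F.P K).sitesPerDir 0) => suToUnits N (u ((siteToLit (F.P K) 0).symm (bpos b)))) x :=
    laplaceALatticeK_G1LatticeK hpos' _
  have h2 : laplaceAOfRecord F N k U₀ (QOfRecord F N k U₀) (QflatOfRecord F N k) a (G1LatticeK hpos x) = x := laplaceALatticeK_G1LatticeK hpos _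
  show laplaceAOfRecord F N k (gaugeAct u U₀) (QOfRecord F N k (gaugeAct u U₀)) (QflatOfRecord F N k) a _ =
    laplaceAOfRecord F N k (gaugeAct u U₀) (QOfRecord F N k (gaugeAct u U₀)) (QflatOfRecord F N k) a _
  rw [h1, laplaceAOfRecord_gaugeAct F N k u U₀ hk h a, h2]

/-- **`(QG₁Q*)(u • U₀) R_k(u) = R_k(u) (QG₁Q*)(U₀)`** — composition of (3.32), (3.34b) and the `Q*`-slot. [cite: Balaban1985BackgroundPropagators, (3.32)–(3.34) p.396; Balaban1985Variational, (45) p.285] -/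
theorem QG1Qadj_gaugeAct [Fact (0 < c0Rec F K k)] [Fact (∀ c, 0 < wBRec F K k c)] (hk : k ≤ (F.P K).m + (F.P K).K)
    (h : SmallBelow (avOfRecord F N K) k U₀) {a : ℝ}
    (hpos : ∀ x, x ≠ 0 → 0 < RCLike.re ⟪x, laplaceAOfRecord F N k U₀ (QOfRecord F N k U₀) (QflatOfRecord F N k) a x⟫_ℂ)
    (hpos' : ∀ x, x ≠ 0 → 0 < RCLike.re ⟪x, laplaceAOfRecord F N k (gaugeAct u U₀) (QOfRecord F N k (gaugeAct u U₀)) (QflatOfRecord F N k) a x⟫_ℂ)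
    (y : WL2 ℂ (wBRec F K k) (WRec N)) :
    QOfRecord F N k (gaugeAct u U₀) (G1LatticeK hpos' (LinearMap.adjoint (QOfRecord F N k (gaugeAct u U₀))
        (gaugeW (phiRec N) (fun c : PBond (F.P K) k => suToUnits N (toMS u k c.src)) y))) =
      gaugeW (phiRec N) (fun c : PBond (F.P K) k => suToUnits N (toMS u k c.src))
        (QOfRecord F N k U₀ (G1LatticeK hpos (LinearMap.adjoint (QOfRecord F N k U₀) y))) := by
  rw [adjoint_QOfRecord_gaugeAct F N k u U₀ hk h, G1LatticeK_gaugeAct F N k u U₀ hk h hpos hpos', QOfRecord_gaugeAct_bpos F N k u U₀ hk h]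

/-- ★ **`(QG₁Q*)⁻¹(u • U₀) R_k(u) = R_k(u) (QG₁Q*)⁻¹(U₀)`** for lit's constructed `KinvLatticeK hpos hQ` — `QG₁Q*` is intertwined and invertible (finite dimension:
a surjective endomorphism is injective). [cite: Balaban1985Variational, (45) p.285, (103) p.293; Balaban1985BackgroundPropagators, (3.34) p.396] -/
theorem KinvLatticeK_gaugeAct [Fact (0 < c0Rec F K k)] [Fact (∀ c, 0 < wBRec F K k c)] (hk : k ≤ (F.P K).m + (F.P K).K)
    (h : SmallBelow (avOfRecord F N K) k U₀) {a : ℝ}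
    (hpos : ∀ x, x ≠ 0 → 0 < RCLike.re ⟪x, laplaceAOfRecord F N k U₀ (QOfRecord F N k U₀) (QflatOfRecord F N k) a x⟫_ℂ)
    (hQ : Function.Surjective (QOfRecord F N k U₀))
    (hpos' : ∀ x, x ≠ 0 → 0 < RCLike.re ⟪x, laplaceAOfRecord F N k (gaugeAct u U₀) (QOfRecord F N k (gaugeAct u U₀)) (QflatOfRecord F N k) a x⟫_ℂ)
    (hQ' : Function.Surjective (QOfRecord F N k (gaugeAct u U₀))) (y : WL2 ℂ (wBRec F K k) (WRec N)) :
    KinvLatticeK hpos' hQ' (gaugeW (phiRec N) (fun c : PBond (F.P K) k => suToUnits N (toMS u k c.src)) y) =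
      gaugeW (phiRec N) (fun c : PBond (F.P K) k => suToUnits N (toMS u k c.src)) (KinvLatticeK hpos hQ y) := by
  -- `K′ := (QG₁Q*)(u • U₀)` as an endomorphism of the coarse block space
  set K' : WL2 ℂ (wBRec F K k) (WRec N) →ₗ[ℂ] WL2 ℂ (wBRec F K k) (WRec N) :=
    QOfRecord F N k (gaugeAct u U₀) ∘ₗ G1LatticeK hpos' ∘ₗ LinearMap.adjoint (QOfRecord F N k (gaugeAct u U₀)) with hK'
  have hsurj : Function.Surjective K' := fun z => ⟨KinvLatticeK hpos' hQ' z, hK_lattice hpos' hQ' z⟩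
  have hinj : Function.Injective K' := LinearMap.injective_iff_surjective.2 hsurj
  apply hinj
  show QOfRecord F N k (gaugeAct u U₀) (G1LatticeK hpos' (LinearMap.adjoint (QOfRecord F N k (gaugeAct u U₀)) _)) =
    QOfRecord F N k (gaugeAct u U₀) (G1LatticeK hpos' (LinearMap.adjoint (QOfRecord F N k (gaugeAct u U₀)) _))
  rw [hK_lattice hpos' hQ', QG1Qadj_gaugeAct F N k u U₀ hk h hpos hpos', hK_lattice hpos hQ]

omit [NeZero N] in
/-- ★★ **BOOKKEEPING: `𝔊(U₀)f` IS `G₁𝔓*` OF LIT'S HILBERT LETTERS** — the configuration underlying `frakGOfRecordAtBgFlat … U₀ a hpos hQ f` is `phiRec` of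
`G₁x − G₁Q†(QG₁Q*)⁻¹QG₁x − G₁ D R D† G₁x` ([B9] (3.153)) for the fine bond function `x` reading `f` (`G₁ = G1LatticeK hpos`, `(QG₁Q*)⁻¹ = KinvLatticeK hpos hQ`, `D`∕`D†` = (3.3)∕(3.8),
`R = RrOfRecord U₀ Q′♭`). [cite: Balaban1985BackgroundPropagators, (3.153) p.426; Balaban1985Variational, (110)–(111) p.294] -/
theorem frakGOfRecordAtBgFlat_equiv [Fact (0 < (F.L : ℝ))] [Fact (0 < (F.P K).eta k)] [Fact (0 < c0Rec F K k)] [Fact (∀ c, 0 < wBRec F K k c)]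
    (Ω : ℕ → Set (Site (F.P K) 0)) {a : ℝ}
    (hpos : ∀ x, x ≠ 0 → 0 < RCLike.re ⟪x, laplaceAOfRecord F N k U₀ (QOfRecord F N k U₀) (QflatOfRecord F N k) a x⟫_ℂ)
    (hQ : Function.Surjective (QOfRecord F N k U₀)) (x : BondL2K ℂ (F.P K).d (fun _ => (F.P K).sitesPerDir 0) (c0Rec F K k) (WRec N))
    (f : NegSizeLit F N K k Ω 3) (hfx : NegSup.equiv _ _ f = funEquiv (phiRec N) (fun _ => c0Rec F K k) x) :
    JetSup.equiv _ _ _ (frakGOfRecordAtBgFlat F N K k Ω U₀ a hpos hQ f) =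
      funEquiv (phiRec N) (fun _ => c0Rec F K k)
        (G1LatticeK hpos x - G1LatticeK hpos (LinearMap.adjoint (QOfRecord F N k U₀) (KinvLatticeK hpos hQ (QOfRecord F N k U₀ (G1LatticeK hpos x)))) -
          G1LatticeK hpos (covDerivL2K ℂ (c0Rec F K k) (cRec F K k) (RRec F N U₀) (RrOfRecord F N k U₀ (QflatOfRecord F N k)
            (covDivL2K ℂ (c0Rec F K k) (cRec F K k) (SRec F N U₀) (G1LatticeK hpos x))))) := by
  rw [frakGOfRecordAtBgFlat_eq, frakGOfRecord_eq_frakG, frakG_apply, frakGLin_apply, hfx]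
  simp only [G1Fun, QFun, QadjFun, DFun, DstarFun, readFun_apply, LinearMap.comp_apply, LinearEquiv.coe_coe, LinearEquiv.symm_apply_apply, map_sub]

/-- ★★ **`𝔊` IS GAUGE COVARIANT: `𝔊(u • U₀)(Ad_u f) = Ad_u (𝔊(U₀) f)`** on the underlying bond functions (`Ad_u` = `b ↦ Ad_{u(b₋)}`), for def-Y's handle
`frakGOfRecordAtBgFlat` on 35b's guard — [B9] (3.34b) pushed through (3.153) `𝔊 = G₁𝔓*` letter by letter (`G1LatticeK_gaugeAct`, `KinvLatticeK_gaugeAct`, ✓p816707 (3.32),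
✓p817063 (3.31)∕(3.33b)). [cite: Balaban1985BackgroundPropagators, (3.34) p.396, (3.153) p.426, p.398; Balaban1985Variational, (111) p.294, (117) p.295] -/
theorem frakGOfRecordAtBgFlat_gaugeAct [Fact (0 < (F.L : ℝ))] [Fact (0 < (F.P K).eta k)] [Fact (0 < c0Rec F K k)] [Fact (∀ c, 0 < wBRec F K k c)]
    (Ω : ℕ → Set (Site (F.P K) 0)) (hk : k ≤ (F.P K).m + (F.P K).K) (h : SmallBelow (avOfRecord F N K) k U₀) {a : ℝ}
    (hpos : ∀ x, x ≠ 0 → 0 < RCLike.re ⟪x, laplaceAOfRecord F N k U₀ (QOfRecord F N k U₀) (QflatOfRecord F N k) a x⟫_ℂ)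
    (hQ : Function.Surjective (QOfRecord F N k U₀))
    (hpos' : ∀ x, x ≠ 0 → 0 < RCLike.re ⟪x, laplaceAOfRecord F N k (gaugeAct u U₀) (QOfRecord F N k (gaugeAct u U₀)) (QflatOfRecord F N k) a x⟫_ℂ)
    (hQ' : Function.Surjective (QOfRecord F N k (gaugeAct u U₀))) (f f' : NegSizeLit F N K k Ω 3)
    (hff' : NegSup.equiv _ _ f' = fun b => AdA (suToUnits N (u ((siteToLit (F.P K) 0).symm (bpos b)))) (NegSup.equiv _ _ f b)) :
    JetSup.equiv _ _ _ (frakGOfRecordAtBgFlat F N K k Ω (gaugeAct u U₀) a hpos' hQ' f') =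
      fun b => AdA (suToUnits N (u ((siteToLit (F.P K) 0).symm (bpos b)))) (JetSup.equiv _ _ _ (frakGOfRecordAtBgFlat F N K k Ω U₀ a hpos hQ f) b) := by
  set x := (funEquiv (phiRec N) (fun _ : Bond (F.P K).d (fun _ => (F.P K).sitesPerDir 0) => c0Rec F K k)).symm (NegSup.equiv _ _ f) with hx
  have hfx : NegSup.equiv _ _ f = funEquiv (phiRec N) (fun _ => c0Rec F K k) x := by rw [hx, LinearEquiv.apply_symm_apply]
  have hf'x : NegSup.equiv _ _ f' = funEquiv (phiRec N) (fun _ => c0Rec F K k)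
      (gaugeW (phiRec N) (fun b : Bond (F.P K).d (fun _ => (F.P K).sitesPerDir 0) => suToUnits N (u ((siteToLit (F.P K) 0).symm (bpos b)))) x) := by
    rw [hff', funEquiv_gaugeW, ← hfx]
  rw [frakGOfRecordAtBgFlat_equiv F N k (gaugeAct u U₀) Ω hpos' hQ' _ f' hf'x, frakGOfRecordAtBgFlat_equiv F N k U₀ Ω hpos hQ x f hfx,
    G1LatticeK_gaugeAct F N k u U₀ hk h hpos hpos', QOfRecord_gaugeAct_bpos F N k u U₀ hk h, KinvLatticeK_gaugeAct F N k u U₀ hk h hpos hQ hpos' hQ',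
    adjoint_QOfRecord_gaugeAct F N k u U₀ hk h, G1LatticeK_gaugeAct F N k u U₀ hk h hpos hpos', covDivL2K_SRec_gaugeAct F N k u U₀,
    RrOfRecord_gaugeAct F N k u U₀, covDerivL2K_RRec_gaugeAct F N k u U₀, G1LatticeK_gaugeAct F N k u U₀ hk h hpos hpos', ← map_sub, ← map_sub,
    funEquiv_gaugeW]

end Hilbert

/-! ## §3  The (115)∕(−3) carriers of record are `Ad`-isometric; the (115)-derivative is covariant -/

section Carriers

variable (u : GaugeTransf (F.P K) 0 (SU N)) (U₀ : GaugeField (F.P K) 0 (SU N))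

/-- ★ **THE DERIVATIVE OF (115) IS COVARIANT**: `∇^{u • U₀}(Ad_u G)(b, ν) = Ad_{u(b₋)} (∇^{U₀} G)(b, ν)` for lit's `nabla115 η (unitsOfRecord ·)` ([B9] (3.3) componentwise).
[cite: Balaban1985BackgroundPropagators, (3.3) p.391, (3.31) p.395; Balaban1985Variational, (115) p.294] -/
theorem nabla115_unitsOfRecord_gaugeAct (G : Bond (F.P K).d (fun _ => (F.P K).sitesPerDir 0) → Matrix (Fin N) (Fin N) ℂ)
    (p : Bond (F.P K).d (fun _ => (F.P K).sitesPerDir 0) × Fin (F.P K).d) :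
    nabla115 ((F.P K).eta k) (unitsOfRecord F N (gaugeAct u U₀))
        (fun c : Bond (F.P K).d (fun _ => (F.P K).sitesPerDir 0) => AdA (suToUnits N (u ((siteToLit (F.P K) 0).symm (bpos c)))) (G c)) p =
      AdA (suToUnits N (u ((siteToLit (F.P K) 0).symm (bpos p.1)))) (nabla115 ((F.P K).eta k) (unitsOfRecord F N U₀) G p) := by
  obtain ⟨b, ν⟩ := p
  rw [nabla115_apply, nabla115_apply, unitsOfRecord_gaugeAct, gaugeU_apply]
  simp only [AdA_apply, Units.val_mul, mul_inv_rev, inv_inv, smul_sub, mul_sub, sub_mul, mul_smul_comm, smul_mul_assoc, mul_assoc,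
    Units.inv_mul_cancel_left, bpos, btgt]

omit [NeZero N] in
/-- **`|·|_{(−n)}` IS `Ad`-INVARIANT**: two currents whose underlying functions differ by `b ↦ Ad_{s(b)}`, `s(b) ∈ SU(N)`, have the same norm.
[cite: Balaban1985Variational, p.286, (117) p.295; Balaban1985BackgroundPropagators, p.398] -/
theorem norm_negSizeLit_AdA [Fact (0 < (F.L : ℝ))] [Fact (0 < (F.P K).eta k)] (Ω : ℕ → Set (Site (F.P K) 0)) {n : ℕ} (s : Bond (F.P K).d (fun _ => (F.P K).sitesPerDir 0) → SU N)
    (f f' : NegSizeLit F N K k Ω n) (h : NegSup.equiv _ _ f' = fun b => AdA (suToUnits N (s b)) (NegSup.equiv _ _ f b)) : ‖f'‖ = ‖f‖ := by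
  have hp : NegSup.profile _ f' = NegSup.profile _ f := by
    funext b
    simp only [NegSup.profile_apply, h, norm_AdA_suToUnits]
  rw [NegSup.norm_def f', NegSup.norm_def f, hp]

/-- **THE NORM OF (115) IS `Ad`-INVARIANT ALONG THE ORBIT**: a configuration over `u • U₀` whose underlying function is `Ad_u` of one over `U₀` has the same
`max{|·|_{(−1)}, |∇·|_{(−2)}}` (the derivative being covariant, `nabla115_unitsOfRecord_gaugeAct`). [cite: Balaban1985Variational, (115) p.294; Balaban1985BackgroundPropagators, p.398] -/
theorem norm_space115Lit_AdA [Fact (0 < (F.L : ℝ))] [Fact (0 < (F.P K).eta k)] (Ω : ℕ → Set (Site (F.P K) 0)) (X : Space115Lit F N K k Ω U₀) (X' : Space115Lit F N K k Ω (gaugeAct u U₀))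
    (h : JetSup.equiv _ _ _ X' = fun b => AdA (suToUnits N (u ((siteToLit (F.P K) 0).symm (bpos b)))) (JetSup.equiv _ _ _ X b)) : ‖X'‖ = ‖X‖ := by
  have hfst : NegSup.profile _ (JetSup.fst X') = NegSup.profile _ (JetSup.fst X) := by
    funext b
    simp only [NegSup.profile_apply, JetSup.equiv_fst, h, norm_AdA_suToUnits]
  have hsnd : NegSup.profile _ (JetSup.snd X') = NegSup.profile _ (JetSup.snd X) := by
    funext p
    simp only [NegSup.profile_apply, JetSup.equiv_snd, h, nabla115_unitsOfRecord_gaugeAct, norm_AdA_suToUnits]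
  rw [JetSup.norm_def X', JetSup.norm_def X, NegSup.norm_def (JetSup.fst X'), NegSup.norm_def (JetSup.fst X), NegSup.norm_def (JetSup.snd X'),
    NegSup.norm_def (JetSup.snd X), hfst, hsnd]

end Carriers

/-! ## §4  [15] (117)'s norm `‖𝔊(U₀)‖` is constant along gauge orbits (on the guard); every pure gauge `u • 1` -/

section Norm

variable (u : GaugeTransf (F.P K) 0 (SU N)) (U₀ : GaugeField (F.P K) 0 (SU N))

/-- ★★★ **GAUGE INVARIANCE OF THE (117)-NORM OF def-Y's `𝔊`**: `‖𝔊(u • U₀)‖ = ‖𝔊(U₀)‖` as operators `|·|_{(−3)} → (115)` — conjunct C4 of `P0Content` (`‖frakGOfRecordAtBgFlat …‖ ≤ B₀`) holds at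
`u • U₀` iff at `U₀`, whatever displayed proofs `hpos`, `hQ` are supplied (print p.398: *«All these inequalities are invariant with respect to gauge transformations of U»*).
[cite: Balaban1985Variational, (117) p.295; Balaban1985BackgroundPropagators, (3.34) p.396, p.398] -/
theorem norm_frakGOfRecordAtBgFlat_gaugeAct [Fact (0 < (F.L : ℝ))] [Fact (0 < (F.P K).eta k)] [Fact (0 < c0Rec F K k)] [Fact (∀ c, 0 < wBRec F K k c)]
    (Ω : ℕ → Set (Site (F.P K) 0)) (hk : k ≤ (F.P K).m + (F.P K).K) (h : SmallBelow (avOfRecord F N K) k U₀) {a : ℝ}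
    (hpos : ∀ x, x ≠ 0 → 0 < RCLike.re ⟪x, laplaceAOfRecord F N k U₀ (QOfRecord F N k U₀) (QflatOfRecord F N k) a x⟫_ℂ)
    (hQ : Function.Surjective (QOfRecord F N k U₀))
    (hpos' : ∀ x, x ≠ 0 → 0 < RCLike.re ⟪x, laplaceAOfRecord F N k (gaugeAct u U₀) (QOfRecord F N k (gaugeAct u U₀)) (QflatOfRecord F N k) a x⟫_ℂ)
    (hQ' : Function.Surjective (QOfRecord F N k (gaugeAct u U₀))) :
    ‖frakGOfRecordAtBgFlat F N K k Ω (gaugeAct u U₀) a hpos' hQ'‖ = ‖frakGOfRecordAtBgFlat F N K k Ω U₀ a hpos hQ‖ := by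
  apply le_antisymm
  · refine ContinuousLinearMap.opNorm_le_bound _ (norm_nonneg (frakGOfRecordAtBgFlat F N K k Ω U₀ a hpos hQ)) fun f' => ?_
    set f : NegSizeLit F N K k Ω 3 :=
      (NegSup.equiv _ _).symm (fun b => AdA (suToUnits N (u ((siteToLit (F.P K) 0).symm (bpos b))))⁻¹ (NegSup.equiv _ _ f' b)) with hf
    have hff' : NegSup.equiv _ _ f' = fun b => AdA (suToUnits N (u ((siteToLit (F.P K) 0).symm (bpos b)))) (NegSup.equiv _ _ f b) := by
      funext b
      simp only [hf, Equiv.apply_symm_apply, AdA_apply_inv]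
    rw [norm_space115Lit_AdA F N k u U₀ Ω _ _ (frakGOfRecordAtBgFlat_gaugeAct F N k u U₀ Ω hk h hpos hQ hpos' hQ' f f' hff'),
      norm_negSizeLit_AdA F N k Ω _ f f' hff']
    exact ContinuousLinearMap.le_opNorm _ f
  · refine ContinuousLinearMap.opNorm_le_bound _ (norm_nonneg (frakGOfRecordAtBgFlat F N K k Ω (gaugeAct u U₀) a hpos' hQ')) fun f => ?_
    set f' : NegSizeLit F N K k Ω 3 :=
      (NegSup.equiv _ _).symm (fun b => AdA (suToUnits N (u ((siteToLit (F.P K) 0).symm (bpos b)))) (NegSup.equiv _ _ f b)) with hf'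
    have hff' : NegSup.equiv _ _ f' = fun b => AdA (suToUnits N (u ((siteToLit (F.P K) 0).symm (bpos b)))) (NegSup.equiv _ _ f b) := by
      rw [hf', Equiv.apply_symm_apply]
    rw [← norm_space115Lit_AdA F N k u U₀ Ω _ _ (frakGOfRecordAtBgFlat_gaugeAct F N k u U₀ Ω hk h hpos hQ hpos' hQ' f f' hff'),
      ← norm_negSizeLit_AdA F N k Ω _ f f' hff']
    exact ContinuousLinearMap.le_opNorm _ f'

omit U₀ in
/-- ★★★ **EVERY PURE GAUGE HAS THE FLAT BACKGROUND'S (117)-NORM**: `‖𝔊(u • 1)‖ = ‖𝔊(1)‖` for def-Y's handle (the flat background is on the guard at every level, ✓`smallBelow_one`;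
`hpos`∕`hQ` at `u • 1` are inhabited by ✓`laplaceAOfRecord_pureGauge_pos` ∕ `QOfRecord_surjective_gaugeAct` + ✓`QOfRecord_one_surjective`). So C4 of `P0Content` on the whole gauge
orbit of `1` ⟸ C4 at `U₀ = 1`. [cite: Balaban1985Variational, (117) p.295; Balaban1985BackgroundPropagators, p.398] -/
theorem norm_frakGOfRecordAtBgFlat_pureGauge [Fact (0 < (F.L : ℝ))] [Fact (0 < (F.P K).eta k)] [Fact (0 < c0Rec F K k)] [Fact (∀ c, 0 < wBRec F K k c)]
    (Ω : ℕ → Set (Site (F.P K) 0)) (hk : k ≤ (F.P K).m + (F.P K).K) {a : ℝ}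
    (hpos₁ : ∀ x, x ≠ 0 → 0 < RCLike.re ⟪x, laplaceAOfRecord F N k 1 (QOfRecord F N k 1) (QflatOfRecord F N k) a x⟫_ℂ)
    (hQ₁ : Function.Surjective (QOfRecord F N k (1 : GaugeField (F.P K) 0 (SU N))))
    (hpos' : ∀ x, x ≠ 0 → 0 < RCLike.re ⟪x, laplaceAOfRecord F N k (gaugeAct u 1) (QOfRecord F N k (gaugeAct u 1)) (QflatOfRecord F N k) a x⟫_ℂ)
    (hQ' : Function.Surjective (QOfRecord F N k (gaugeAct u 1))) :
    ‖frakGOfRecordAtBgFlat F N K k Ω (gaugeAct u 1) a hpos' hQ'‖ = ‖frakGOfRecordAtBgFlat F N K k Ω 1 a hpos₁ hQ₁‖ :=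
  norm_frakGOfRecordAtBgFlat_gaugeAct F N k u 1 Ω hk (N07LaplaceAOfRecordGaugeOrbitPos.smallBelow_one N k) hpos₁ hQ₁ hpos' hQ'

end Norm

end Summit.QuantumFields.YangMills.Theorems.N07FrakGOfRecordGaugeCovariance

end
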